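import Summits.KontsevichZagierPeriods.KontsevichZagierPeriods.Theses.FermatIsogeny
import Summits.KontsevichZagierPeriods.KontsevichZagierPeriods.Theorems.FermatIsogenyBetaProductSectorStubQuadStepCore
import Summits.KontsevichZagierPeriods.KontsevichZagierPeriods.Theorems.FermatIsogenyBetaProductSectorStubDirichletReassociation
import Literature.NumberTheory.Transcendental.KZCubeProducts
import Literature.NumberTheory.Transcendental.KZRelationsLE

/-!
# `BetaProductSector` (stmt-KontsevichZagierPeriods-3898), line `registered` (v3) — stub `stub_quadStep`,
# part 3: the quadratic move QUAD

THE QUADRATIC MOVE "QUAD" of the line (the (2,2) shadow of Gauss's quadratic transformation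
`₂F₁(y-½, y; 2y; z)`, Andrews–Askey–Roy 1999 Thm 3.1.3; in Γ-form two Legendre duplications):

  `B(x,y) · B(x+½,y) = 2 · B(2x,2y) · B(½,y)`     (`x, y > 0`),

realised INSIDE the Kontsevich–Zagier calculus of moves between the two PINNED product representations
`r = [(0,1)², c s^{x-1}(1-s)^{y-1} t^{x-½}(1-t)^{y-1}]` and
`r' = [(0,1)², 2c u^{2x-1}(1-u)^{2y-1} v^{-½}(1-v)^{y-1}]`, uniformly in a real-algebraic weight `c`, WITHOUT
cancellation (no division by a common Beta factor, no division by `2` in `FormalRep`). Chain: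

1. unweighted source `u₀ = [(0,1)², s^{x-1}(1-s)^{y-1} t^{x-½}(1-t)^{y-1}]` as a box-Mellin member
   (`KZ.IsMellinMemberWith`, family `(X₀, 1-X₀, X₁, 1-X₁)`); the Kummer coverings `s = σ²`, `t = τ²`
   (`KZ.IsMellinMemberWith.of_sub_of_mem_relations_dilate`, rule (2) twice) give
   `u₂ = [(0,1)², 4 σ^{2x-1} τ^{2x} ((1-σ²)(1-τ²))^{y-1}]`;
2. the two-dimensional core `u₂ ∼ u₆ = [(0,1)², 4 p^{2x-1}(1-p)^{2y-1}(1-w²)^{y-1}]` of part 2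
   (`stub_quadCore`: fold the box onto the wedge `{σ<τ}` by the coordinate swap, symmetric chart
   `(σ,τ) ↦ (στ, τ-σ)` onto the simplex — `(1-στ)²-(τ-σ)² = (1-σ²)(1-τ²)` — then the linear Dirichlet chart);
3. the Kummer covering `v = w²` in the second variable: `u₆ ∼ u₇ = [(0,1)², 2 u^{2x-1}(1-u)^{2y-1}v^{-½}(1-v)^{y-1}]`;
4. scale the whole chain by `c` (`KZ.Equivalent.constMul`) and pin `r`, `r'` to its ends (rule (1)).

Value bookkeeping: `∫∫ 4σ^{2x-1}τ^{2x}((1-σ²)(1-τ²))^{y-1} = B(x,y)B(x+½,y)` and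
`∫∫ 4p^{2x-1}(1-p)^{2y-1}(1-w²)^{y-1} = 4·B(2x,2y)·½B(½,y)`. Everything is proved; no `def`, no named fact.

References: Kontsevich–Zagier 2001 §1.2 (rules (1), (2)); Andrews–Askey–Roy 1999 Thm 3.1.3, Thm 1.5.1.
-/

noncomputable section

open MeasureTheory Set
open Literature.ModelTheory.ExponentialFields (IsSemialgebraic)
open MvPolynomial (aeval X C)

namespace Summit.KontsevichZagierPeriods.FermatIsogeny.BetaProductSectorStubs

open Literature.NumberTheory.Transcendental
open Literature.NumberTheory.Transcendental.KZ

namespace QuadStep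

/-! ## The Beta box as a Mellin member -/

/-- The Mellin box of the Beta family `(X₀, 1-X₀, X₁, 1-X₁)` is the open box `(0,1)²` (the four strict
inequalities are those of the box). [folklore] -/
theorem mellinBox_betaBox :
    KZ.mellinBox (![X 0, 1 - X 0, X 1, 1 - X 1] : Fin 4 → MvPolynomial (Fin 2) ℚ) =
      {z | ∀ i, z i ∈ Set.Ioo (0:ℝ) 1} := by
  ext z
  simp only [KZ.mem_mellinBox, mem_setOf_eq]
  constructor
  · exact fun h => h.1
  · intro h
    refine ⟨h, fun k => ?_⟩
    have h0 := h 0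
    have h1 := h 1
    fin_cases k
    · simpa using h0.1
    · simpa [sub_pos] using h0.2
    · simpa using h1.1
    · simpa [sub_pos] using h1.2

/-- The Euler–Mellin integrand of the Beta family `(X₀, 1-X₀, X₁, 1-X₁)`, unfolded:
`κ · z₀^{e₀} (1-z₀)^{e₁} z₁^{e₂} (1-z₁)^{e₃}`. [folklore] -/
theorem mellin_betaBox_apply (e : Fin 4 → ℚ) (κ : ℚ) (z : Fin 2 → ℝ) :
    KZ.mellinIntegrand (![X 0, 1 - X 0, X 1, 1 - X 1] : Fin 4 → MvPolynomial (Fin 2) ℚ) e κ z =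
      κ * ((z 0) ^ ((e 0 : ℚ) : ℝ) * (1 - z 0) ^ ((e 1 : ℚ) : ℝ) * (z 1) ^ ((e 2 : ℚ) : ℝ) *
        (1 - z 1) ^ ((e 3 : ℚ) : ℝ)) := by
  rw [KZ.mellinIntegrand_apply, Fin.prod_univ_four]
  simp only [Matrix.cons_val_zero, Matrix.cons_val_one, Matrix.cons_val, map_sub, map_one,
    MvPolynomial.aeval_X]

/-- **The weighted Beta box `[(0,1)², κ z₀^{a-1}(1-z₀)^{b-1} z₁^{a'-1}(1-z₁)^{b'-1}]` converges** for positive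
rational data (Tonelli and Euler's Beta integral: `KZ.integrableOn_cubeBetaIntegrand`), in the Mellin
presentation. [cite: KontsevichZagier2001, §1.1] -/
theorem integrableOn_betaBox (a b a' b' κ : ℚ) (ha : 0 < a) (hb : 0 < b) (ha' : 0 < a') (hb' : 0 < b') :
    IntegrableOn (KZ.mellinIntegrand (![X 0, 1 - X 0, X 1, 1 - X 1] : Fin 4 → MvPolynomial (Fin 2) ℚ)
        ![a - 1, b - 1, a' - 1, b' - 1] κ)
      (KZ.mellinBox (![X 0, 1 - X 0, X 1, 1 - X 1] : Fin 4 → MvPolynomial (Fin 2) ℚ)) := by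
  rw [mellinBox_betaBox]
  have h := (KZ.integrableOn_cubeBetaIntegrand ![a, a'] ![b, b']
    (Fin.forall_fin_two.2 ⟨⟨ha, hb⟩, ⟨ha', hb'⟩⟩)).const_mul ((κ : ℚ) : ℝ)
  refine IntegrableOn.congr_fun h (fun z _ => ?_) (KZ.measurableSet_setOf_forall_apply_mem_Ioo 2)
  rw [mellin_betaBox_apply]
  simp only [Fin.prod_univ_two, Matrix.cons_val_zero, Matrix.cons_val_one, Matrix.cons_val]
  push_cast
  ring

/-- `(t²)^e · t = t^{2e+1}` for `t > 0` (the Jacobian bookkeeping of a Kummer covering `t ↦ t²`). [folklore] -/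
theorem sq_rpow_mul_self {t : ℝ} (ht : 0 < t) (e : ℝ) : (t ^ 2) ^ e * t = t ^ (2 * e + 1) := by
  rw [← Real.rpow_two, ← Real.rpow_mul ht.le, Real.rpow_add_one ht.ne']

/-- The pull-back bookkeeping of the two Kummer coverings `s = σ²`, `t = τ²` of the source box. [folklore] -/
theorem quad_source_identity (e₁ e₂ e₃ : ℝ) {s t : ℝ} (hs : 0 < s) (ht : 0 < t) (hs1 : s < 1) (ht1 : t < 1) :
    (s ^ 2) ^ e₁ * (1 - s ^ 2) ^ e₃ * (t ^ 2) ^ e₂ * (1 - t ^ 2) ^ e₃ * (2 * s) * (2 * t) =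
      4 * s ^ (2 * e₁ + 1) * t ^ (2 * e₂ + 1) * ((1 - s ^ 2) * (1 - t ^ 2)) ^ e₃ := by
  have hs2 : 0 ≤ 1 - s ^ 2 := by nlinarith
  have ht2 : 0 ≤ 1 - t ^ 2 := by nlinarith
  rw [Real.mul_rpow hs2 ht2, ← sq_rpow_mul_self hs, ← sq_rpow_mul_self ht]
  ring

/-- The pull-back bookkeeping of the Kummer covering `v = w²` of the target box: `(w²)^{-½} · 2w = 2`. [folklore] -/
theorem quad_target_identity (A B e₃ : ℝ) {w : ℝ} (hw : 0 < w) :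
    2 * (A * B * (w ^ 2) ^ ((1:ℝ) / 2 - 1) * (1 - w ^ 2) ^ e₃) * (2 * w) = 4 * A * B * (1 - w ^ 2) ^ e₃ := by
  have h : (w ^ 2) ^ ((1:ℝ) / 2 - 1) * w = 1 := by
    rw [sq_rpow_mul_self hw, show (2 * ((1:ℝ) / 2 - 1) + 1 : ℝ) = 0 by ring, Real.rpow_zero]
  linear_combination (4 * A * B * (1 - w ^ 2) ^ e₃) * h

end QuadStep

open QuadStep DirichletReassoc in
/-- **Stub `stub_quadStep` — THE QUADRATIC MOVE "QUAD"** (first landed instance of the line's `stub_uniformStep`):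
the Beta-product identity `B(x,y)·B(x+½,y) = 2·B(2x,2y)·B(½,y)` — the (2,2) shadow of Gauss's quadratic
transformation (Andrews–Askey–Roy 1999, Thm 3.1.3), i.e. Legendre's duplication at `x` and at `x+y` — realised as
a chain of moves of the Kontsevich–Zagier calculus between the pinned representations
`[(0,1)², c s^{x-1}(1-s)^{y-1} t^{x-½}(1-t)^{y-1}]` and `[(0,1)², 2c u^{2x-1}(1-u)^{2y-1} v^{-½}(1-v)^{y-1}]`,
uniformly in the real-algebraic weight `c` and without cancellation: Kummer coverings `s = σ²`, `t = τ²`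
(rule 2), the two-dimensional core `stub_quadCore` (fold by the swap, symmetric chart `(στ, τ-σ)`, linear
Dirichlet chart), the Kummer covering `v = w²` (rule 2), scaling by `c`, pinning (rule 1).
[cite: AndrewsAskeyRoy1999, Thm 3.1.3] -/
theorem stub_quadStep : ∀ (x y : ℚ) (c : ℝ), 0 < x → 0 < y → IsAlgebraic ℚ c → ∀ (r r' : Literature.NumberTheory.Transcendental.KZ.IntegralRep 2), r.domain = {x | ∀ i, x i ∈ Set.Ioo (0:ℝ) 1} → Set.EqOn r.integrand (fun z => c * (z 0) ^ ((x:ℝ) - 1) * (1 - z 0) ^ ((y:ℝ) - 1) * (z 1) ^ (((x + 1/2 : ℚ):ℝ) - 1) * (1 - z 1) ^ ((y:ℝ) - 1)) r.domain → r'.domain = {x | ∀ i, x i ∈ Set.Ioo (0:ℝ) 1} → Set.EqOn r'.integrand (fun z => (2 * c) * (z 0) ^ (((2 * x : ℚ):ℝ) - 1) * (1 - z 0) ^ (((2 * y : ℚ):ℝ) - 1) * (z 1) ^ (((1/2 : ℚ):ℝ) - 1) * (1 - z 1) ^ ((y:ℝ) - 1)) r'.domain → Literature.NumberTheory.Transcendental.KZ.Equivalent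 r r' := by
  intro x y c hx hy hc r r' hrd hri hr'd hr'i
  have hx2 : 0 < x + 1 / 2 := by positivity
  have h2x : 0 < 2 * x := by positivity
  have h2y : 0 < 2 * y := by positivity
  have hhalf : (0:ℚ) < 1 / 2 := by norm_num
  -- (1) the unweighted source as a Mellin member and its two Kummer coverings
  obtain ⟨u₀, h₀⟩ := (KZ.exists_isMellinMemberWith_iff _ _ _).2
    (integrableOn_betaBox x y (x + 1 / 2) y 1 hx hy hx2 hy)
  obtain ⟨u₁, h₁⟩ := (KZ.exists_isMellinMemberWith_iff _ _ _).2
    (h₀.integrableOn_dilate (j := (0 : Fin 2)) (k := 1))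
  obtain ⟨u₂, h₂⟩ := (KZ.exists_isMellinMemberWith_iff _ _ _).2
    (h₁.integrableOn_dilate (j := (1 : Fin 2)) (k := 1))
  have e₁₀ : KZ.Equivalent u₁ u₀ := h₁.of_sub_of_mem_relations_dilate h₀
  have e₂₁ : KZ.Equivalent u₂ u₁ := h₂.of_sub_of_mem_relations_dilate h₁
  have hne01 : (0 : Fin 2) ≠ 1 := by decide
  have hne10 : (1 : Fin 2) ≠ 0 := by decide
  have hu₂d : u₂.domain = {z | ∀ i, z i ∈ Set.Ioo (0:ℝ) 1} := by
    rw [h₂.1, KZ.mellinBox_dilateData, KZ.mellinBox_dilateFamily, KZ.mellinBox_dilateData,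
      KZ.mellinBox_dilateFamily, mellinBox_betaBox]
    ext z
    simp only [mem_inter_iff, mem_preimage, mem_setOf_eq]
    exact ⟨fun h => h.1, fun h => ⟨h, KZ.boxDilation_mem_box h,
      KZ.boxDilation_mem_box (KZ.boxDilation_mem_box h)⟩⟩
  have hu₂i : Set.EqOn u₂.integrand (fun z => 4 * (z 0) ^ (2 * (x:ℝ) - 1) * (z 1) ^ (2 * (x:ℝ)) *
      ((1 - z 0 ^ 2) * (1 - z 1 ^ 2)) ^ ((y:ℝ) - 1)) u₂.domain := by
    intro z hz
    have hzb : ∀ i, z i ∈ Set.Ioo (0:ℝ) 1 := by rw [hu₂d] at hz; exact hz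
    have key := quad_source_identity ((x:ℝ) - 1) ((x:ℝ) + 1 / 2 - 1) ((y:ℝ) - 1)
      (hzb 0).1 (hzb 1).1 (hzb 0).2 (hzb 1).2
    rw [show 2 * ((x:ℝ) - 1) + 1 = 2 * (x:ℝ) - 1 by ring,
      show 2 * ((x:ℝ) + 1 / 2 - 1) + 1 = 2 * (x:ℝ) by ring] at key
    rw [h₂.2 hz, KZ.mellinIntegrand_dilateData, KZ.mellinIntegrand_dilateData, mellin_betaBox_apply]
    simp only [KZ.boxDilation_apply_self, KZ.boxDilation_apply_of_ne _ hne01, KZ.boxDilation_apply_of_ne _ hne10,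
      Nat.reduceAdd, pow_one, Matrix.cons_val_zero, Matrix.cons_val_one, Matrix.cons_val]
    push_cast
    linear_combination key
  -- (3) the unweighted target as a Mellin member and its Kummer covering in the second variable
  obtain ⟨u₇, h₇⟩ := (KZ.exists_isMellinMemberWith_iff _ _ _).2
    (integrableOn_betaBox (2 * x) (2 * y) (1 / 2) y 2 h2x h2y hhalf hy)
  obtain ⟨u₆, h₆⟩ := (KZ.exists_isMellinMemberWith_iff _ _ _).2
    (h₇.integrableOn_dilate (j := (1 : Fin 2)) (k := 1))
  have e₆₇ : KZ.Equivalent u₆ u₇ := h₆.of_sub_of_mem_relations_dilate h₇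
  have hu₆d : u₆.domain = {z | ∀ i, z i ∈ Set.Ioo (0:ℝ) 1} := by
    rw [h₆.1, KZ.mellinBox_dilateData, KZ.mellinBox_dilateFamily, mellinBox_betaBox]
    ext z
    simp only [mem_inter_iff, mem_preimage, mem_setOf_eq]
    exact ⟨fun h => h.1, fun h => ⟨h, KZ.boxDilation_mem_box h⟩⟩
  have hu₆i : Set.EqOn u₆.integrand (fun z => 4 * (z 0) ^ (2 * (x:ℝ) - 1) * (1 - z 0) ^ (2 * (y:ℝ) - 1) *
      (1 - z 1 ^ 2) ^ ((y:ℝ) - 1)) u₆.domain := by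
    intro z hz
    have hzb : ∀ i, z i ∈ Set.Ioo (0:ℝ) 1 := by rw [hu₆d] at hz; exact hz
    rw [h₆.2 hz, KZ.mellinIntegrand_dilateData, mellin_betaBox_apply]
    simp only [KZ.boxDilation_apply_self, KZ.boxDilation_apply_of_ne _ hne01, Nat.reduceAdd, pow_one,
      Matrix.cons_val_zero, Matrix.cons_val_one, Matrix.cons_val]
    push_cast
    exact quad_target_identity _ _ _ (hzb 1).1
  -- (2) the two-dimensional core, and the unweighted chain `u₀ ∼ u₇`
  have core : KZ.Equivalent u₂ u₆ := stub_quadCore x y hx hy u₂ u₆ hu₂d hu₂i hu₆d hu₆i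
  have chain : KZ.Equivalent u₀ u₇ := (e₁₀.symm.trans e₂₁.symm).trans (core.trans e₆₇)
  -- (4) scale by `c` and pin `r`, `r'`
  have hsc : KZ.Equivalent (u₀.constMul c hc) (u₇.constMul c hc) := KZ.Equivalent.constMul c hc chain
  have hru : KZ.Equivalent r (u₀.constMul c hc) := by
    refine equivalent_constMul_of_eqOn c hc r u₀ (h₀.1.trans (mellinBox_betaBox.trans hrd.symm))
      (f := fun z => (z 0) ^ ((x:ℝ) - 1) * (1 - z 0) ^ ((y:ℝ) - 1) * (z 1) ^ (((x + 1/2 : ℚ):ℝ) - 1) *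
        (1 - z 1) ^ ((y:ℝ) - 1)) (fun z hz => ?_) (fun z hz => ?_)
    · rw [hri hz]
      simp only [mul_assoc]
    · rw [h₀.2 hz, mellin_betaBox_apply]
      simp only [Matrix.cons_val_zero, Matrix.cons_val_one, Matrix.cons_val]
      push_cast
      ring
  have hr'u : KZ.Equivalent r' (u₇.constMul c hc) := by
    refine equivalent_constMul_of_eqOn c hc r' u₇ (h₇.1.trans (mellinBox_betaBox.trans hr'd.symm))
      (f := fun z => 2 * ((z 0) ^ (((2 * x : ℚ):ℝ) - 1) * (1 - z 0) ^ (((2 * y : ℚ):ℝ) - 1) *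
        (z 1) ^ (((1/2 : ℚ):ℝ) - 1) * (1 - z 1) ^ ((y:ℝ) - 1))) (fun z hz => ?_) (fun z hz => ?_)
    · rw [hr'i hz]
      ring
    · rw [h₇.2 hz, mellin_betaBox_apply]
      simp only [Matrix.cons_val_zero, Matrix.cons_val_one, Matrix.cons_val]
      push_cast
      ring
  exact hru.trans (hsc.trans hr'u.symm)

end Summit.KontsevichZagierPeriods.FermatIsogeny.BetaProductSectorStubs

end
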